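import Literature.RingTheory.KTheory.MilnorKBassTateLemma
import HarnessLib

/-!
# `K_n𝔽_q(t) = 0` for `n ≥ 3` and `K₂𝔽_q(t) ≅ ⊕_𝔭 K₁(𝔽_q[t]/𝔭)` (Milnor, *Algebraic K-theory and quadratic forms*, §2 Theorem 2.3 with §1 Example 1.5)

Family `hodge`, lane `lit-hodgefound` (foundations library; seat `lit-hodgefound-p27`, generation 51, row g51-#5);
topic `RingTheory/KTheory`.  Sequel of `MilnorKRatFuncBoundary` (g40-#3: THEOREM 2.3 packaged as the bijection
`z ↦ (ψ z, (∂_𝔭 z)_𝔭)`, `bijective_psiRat_prod_boundaryFamily`, `forall_boundaryAt_eq_zero_iff`, `constMap_injective`),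
of `MilnorKGroupsFiniteField` (g28: EXAMPLE 1.5 «K_nF = 0 for n ≥ 2», `eq_zero_of_finite`), of
`RatFuncPrimeTameSymbols` (g30: the monic generator `monicGen F 𝔭` and the degree `primeDeg F 𝔭` of a non-zero prime of
`F[t]`) and of `MilnorKBassTateLemma` (g45: `finiteDimensional_quotient`, `finrank_quotient_eq_primeDeg : [F[t]/𝔭 : F] = deg 𝔭`).  Companion of
`MilnorKRat` (g51-#4: `K_nℚ ≅ ℤ/2` for `n ≥ 3`) and of `KTwoRatFuncSymbolsFactor` (g30: the same `K₂`-statement for the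
tree's Matsumoto-style `K2Infty (RatFunc F)`, `k2TameEquivOfFinite`).  PROVED THEOREMS only; no definition, no named
fact, no instance (proof-local `letI := Ideal.Quotient.field _` only), no notation, 0 `sorry`, net debt 0 (D-0026).

## The source, verbatim

J. Milnor, *Algebraic K-theory and quadratic forms*, Invent. Math. 9 (1970) 318–344 (held `paper:doi-10-1007-bf01425486`;
bib key `Milnor1970`).  §1 Example 1.5 (p0004 L8–L12): «(Steinberg). If the field is finite, then K₂F = 0. […] This
implies, of course, that K_nF = 0 for n > 2 also.»  §1 Example 1.8 (p0005 L3–L27): «Let F be a global field (that is a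
finite extension of the field Q of rational numbers, or of the field of rational functions in one indeterminate over a
finite field). […] The structure of K_nF is not known for n ≥ 3, but Tate has proved the following partial result: The
quotient K_nF/2K_nF maps isomorphically to the direct sum, over all real completions F_v, of K_nF_v/2K_nF_v ≅ Z/2Z.
[…] It may be conjectured that the subgroup 2K_nF is actually zero for n ≥ 3.»  §2 THEOREM 2.3 (p0008 L12–L16):
«These homomorphisms ∂_π give rise to a split exact sequence 0 → K_nF → K_nF(t) → ⊕ K_{n−1}F[t]/(π) → 0, where the
direct sum extends over all non-zero prime ideals (π).»

For the rational function field `F = 𝔽_q(t)` — a global field with no real completion — Theorem 2.3 and Example 1.5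
settle the conjecture outright: every residue field `𝔽_q[t]/(π)` is finite, so for `n ≥ 3` both ends of the exact
sequence vanish and **`K_n𝔽_q(t) = 0`**, while for `n = 2` the left end `K₂𝔽_q = 0` vanishes and `∂ = (∂_π)_π` is an
isomorphism **`K₂𝔽_q(t) ≅ ⊕_π K₁(𝔽_q[t]/(π)) = ⊕_π (𝔽_q[t]/(π))^×`** (Tate; Bass–Tate prove `K_nF = 0`, `n ≥ 3`, for
every global field of positive characteristic — not formalised here).

## What is formalised (all statements for `K_{n+1}F(t)`, Milnor's `n ≥ 1` shifted as in `MilnorKRatFuncBoundary`)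

* §1 the two vanishing transfers of THEOREM 2.3, for an arbitrary field `F`: if `K_{n+1}F = 0` and
  `K_n(F[t]/𝔭) = 0` for every `𝔭`, then **`K_{n+1}F(t) = 0`** (`eq_zero_of_forall_residue_eq_zero`); if only
  `K_{n+1}F = 0`, then `∂ : K_{n+1}F(t) → ⊕_𝔭 K_n(F[t]/𝔭)` is a bijection (`bijective_boundaryFamily_of_forall_eq_zero`).
* §2 finite `F`, the residue fields: `F[t]/𝔭` is finite (`finite_quotient_asIdeal`) of cardinality
  **`#F ^ deg 𝔭`** (`natCard_quotient_asIdeal`, from the tree's `finrank_quotient_eq_primeDeg`), so `K₁(F[t]/𝔭) ≅ (F[t]/𝔭)^×`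
  (`MilnorK.oneEquiv`) is finite cyclic of order **`#F ^ deg 𝔭 − 1`** (`finite_/natCard_/isAddCyclic_milnorK_one_quotient`).
* §3 finite `F`, the `K`-groups of `F(t)`: **`K_{n+3}F(t) = 0`** (`eq_zero_of_finite_ratFunc`,
  `symbol_eq_zero_of_finite_ratFunc`, `natCard_ratFunc_eq_one`); **`∂ : K₂F(t) → ⊕_𝔭 K₁(F[t]/𝔭)` is a bijection**
  (`bijective_boundaryFamily_two_of_finite`, `eq_zero_iff_forall_boundaryAt_eq_zero_of_finite`).

## References

* [Milnor1970] J. Milnor, *Algebraic K-theory and quadratic forms*, Invent. Math. 9 (1970) 318–344 — §1 Examples 1.5,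
  1.8 (pp. 321–322); §2 Theorem 2.3 (p. 325).
* [BassTate1973] H. Bass, J. Tate, *The Milnor ring of a global field*, in: Algebraic K-theory II, LNM 342 (1973)
  349–446 — the vanishing of `K_nF`, `n ≥ 3`, for global fields of positive characteristic; cited for context only.

Provenance: lane `lit-hodgefound`, seat `lit-hodgefound-p27` gen 51 (agent `literature-prover-lit-hodgefound-p27-g51-0`),
row g51-#5.
-/

set_option autoImplicit false

noncomputable section

namespace Literature.RingTheory.KTheory

namespace MilnorK

open Function Polynomial IsDedekindDomain

variable {F : Type*} [Field F] {n : ℕ}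

/-! ### §1 The vanishing transfers of THEOREM 2.3 (arbitrary base field) -/

section Transfer

/-- **THEOREM 2.3, vanishing transfer.** If `K_{n+1}F = 0` and `K_n(F[t]/𝔭) = 0` for every non-zero prime `𝔭 ⊂ F[t]`, then `K_{n+1}F(t) = 0`: by exactness an element all of whose boundaries `∂_𝔭 z` vanish comes from `K_{n+1}F`. [cite: Milnor1970, §2 Theorem 2.3 (p0008 L12–L16)] -/
theorem eq_zero_of_forall_residue_eq_zero (hF : ∀ x : MilnorK F (n + 1), x = 0)
    (hres : ∀ (v : HeightOneSpectrum F[X]) (y : MilnorK (F[X] ⧸ v.asIdeal) n), y = 0)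
    (z : MilnorK (RatFunc F) (n + 1)) : z = 0 := by
  obtain ⟨b, hb⟩ := (forall_boundaryAt_eq_zero_iff z).1 fun v => hres v _
  rw [← hb, hF b, map_zero]

/-- **THEOREM 2.3, the case `K_{n+1}F = 0`.** If `K_{n+1}F = 0`, then `∂ = (∂_𝔭)_𝔭 : K_{n+1}F(t) → ⊕_𝔭 K_n(F[t]/𝔭)` is a bijection (the split exact sequence with vanishing left end). [cite: Milnor1970, §2 Theorem 2.3 (p0008 L12–L16)] -/
theorem bijective_boundaryFamily_of_forall_eq_zero (hF : ∀ x : MilnorK F (n + 1), x = 0) :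
    Function.Bijective (boundaryFamily : MilnorK (RatFunc F) (n + 1) → FinSuppFamily F n) := by
  have hbij := bijective_psiRat_prod_boundaryFamily (F := F) (n := n)
  constructor
  · intro z₁ z₂ h
    refine hbij.1 ?_
    change (psiRat F (n + 1) z₁, boundaryFamily z₁) = (psiRat F (n + 1) z₂, boundaryFamily z₂)
    rw [hF (psiRat F (n + 1) z₁), hF (psiRat F (n + 1) z₂), h]
  · intro e
    obtain ⟨z, hz⟩ := hbij.2 (0, e)
    exact ⟨z, (Prod.ext_iff.1 hz).2⟩

end Transfer

/-! ### §2 Finite base field: the residue fields `𝔽_q[t]/𝔭` and their `K₁` -/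

section FiniteField

variable [Finite F]

/-- Over a finite field every residue field `F[t]/𝔭` of a non-zero prime is finite: it is a finite-dimensional `F`-space (`finiteDimensional_quotient`, through `F[t]/𝔭 = F[t]/(π)` for the monic generator `π = monicGen F 𝔭`). («the field of rational functions in one indeterminate over a finite field» — its residue class fields are finite.) [cite: Milnor1970, §1 Example 1.8 (p0005 L3–L7)] -/
theorem finite_quotient_asIdeal (v : HeightOneSpectrum F[X]) : Finite (F[X] ⧸ v.asIdeal) := by
  haveI : Module.Finite F (F[X] ⧸ v.asIdeal) := finiteDimensional_quotient v
  exact Module.finite_of_finite F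

/-- **`#(𝔽_q[t]/𝔭) = q ^ deg 𝔭`**: the residue field of a prime of degree `d = primeDeg F 𝔭` has `q ^ d` elements (`finrank_quotient_eq_primeDeg`). [cite: Milnor1970, §1 Example 1.8 (p0005 L3–L7)] -/
theorem natCard_quotient_asIdeal (v : HeightOneSpectrum F[X]) : Nat.card (F[X] ⧸ v.asIdeal) = Nat.card F ^ primeDeg F v := by
  haveI : Finite (F[X] ⧸ v.asIdeal) := finite_quotient_asIdeal v
  letI := Fintype.ofFinite F
  letI := Fintype.ofFinite (F[X] ⧸ v.asIdeal)
  rw [Nat.card_eq_fintype_card, Nat.card_eq_fintype_card, Module.card_eq_pow_finrank (K := F) (V := F[X] ⧸ v.asIdeal),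
    finrank_quotient_eq_primeDeg]

/-- `K₁(𝔽_q[t]/𝔭)` is finite. [cite: Milnor1970, §1 Example 1.5 (p0004 L8–L9)] -/
theorem finite_milnorK_one_quotient (v : HeightOneSpectrum F[X]) : Finite (MilnorK (F[X] ⧸ v.asIdeal) 1) := by
  haveI : Finite (F[X] ⧸ v.asIdeal) := finite_quotient_asIdeal v
  exact Finite.of_equiv _ ((oneEquiv (F[X] ⧸ v.asIdeal)).toEquiv.trans Additive.toMul).symm

/-- **`#K₁(𝔽_q[t]/𝔭) = q ^ deg 𝔭 − 1`**: «K₁F is cyclic, say of order q − 1» for the finite field `F[t]/𝔭` of `q ^ deg 𝔭` elements (`K₁ = ` units, `MilnorK.oneEquiv`). [cite: Milnor1970, §1 Example 1.5 (p0004 L8–L9)] -/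
theorem natCard_milnorK_one_quotient (v : HeightOneSpectrum F[X]) :
    Nat.card (MilnorK (F[X] ⧸ v.asIdeal) 1) = Nat.card F ^ primeDeg F v - 1 := by
  haveI : Finite (F[X] ⧸ v.asIdeal) := finite_quotient_asIdeal v
  letI : Field (F[X] ⧸ v.asIdeal) := Ideal.Quotient.field v.asIdeal
  rw [Nat.card_congr ((oneEquiv (F[X] ⧸ v.asIdeal)).toEquiv.trans Additive.toMul), Nat.card_units,
    natCard_quotient_asIdeal]

/-- **`K₁(𝔽_q[t]/𝔭)` is cyclic** («K₁F is cyclic, say of order q − 1»: the unit group of a finite field). [cite: Milnor1970, §1 Example 1.5 (p0004 L8–L9)] -/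
theorem isAddCyclic_milnorK_one_quotient (v : HeightOneSpectrum F[X]) : IsAddCyclic (MilnorK (F[X] ⧸ v.asIdeal) 1) := by
  haveI : Finite (F[X] ⧸ v.asIdeal) := finite_quotient_asIdeal v
  haveI : IsAddCyclic (Additive (F[X] ⧸ v.asIdeal)ˣ) := isAddCyclic_additive
  exact isAddCyclic_of_surjective ((oneEquiv (F[X] ⧸ v.asIdeal)).symm : Additive (F[X] ⧸ v.asIdeal)ˣ →+ _)
    (oneEquiv (F[X] ⧸ v.asIdeal)).symm.surjective

/-! ### §3 `K_n𝔽_q(t) = 0` for `n ≥ 3` and `K₂𝔽_q(t) ≅ ⊕_𝔭 K₁(𝔽_q[t]/𝔭)` -/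

/-- **`K_n𝔽_q(t) = 0` for `n ≥ 3`** (here `K_{n+3}F(t)`, `F` finite): both ends `K_{n+3}F` and `⊕_𝔭 K_{n+2}(F[t]/𝔭)` of THEOREM 2.3's exact sequence vanish by EXAMPLE 1.5. For the global field `𝔽_q(t)` this is the conjecture «2K_nF is actually zero for n ≥ 3» of Example 1.8 in its sharp form (no real completions). [cite: Milnor1970, §2 Theorem 2.3 (p0008 L12–L16); §1 Example 1.5 (p0004 L8–L12); §1 Example 1.8 (p0005 L22–L27)] -/
theorem eq_zero_of_finite_ratFunc (z : MilnorK (RatFunc F) (n + 3)) : z = 0 :=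
  eq_zero_of_forall_residue_eq_zero (fun x => eq_zero_of_finite x)
    (fun v y => by
      letI : Field (F[X] ⧸ v.asIdeal) := Ideal.Quotient.field v.asIdeal
      haveI : Finite (F[X] ⧸ v.asIdeal) := finite_quotient_asIdeal v
      exact eq_zero_of_finite y) z

/-- **`{f₁, …, f_n} = 0` in `K_n𝔽_q(t)` for `n ≥ 3`.** [cite: Milnor1970, §2 Theorem 2.3 (p0008 L12–L16); §1 Example 1.5 (p0004 L8–L12)] -/
theorem symbol_eq_zero_of_finite_ratFunc (a : Fin (n + 3) → (RatFunc F)ˣ) : symbol a = 0 :=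
  eq_zero_of_finite_ratFunc _

/-- **`K_n𝔽_q(t)` is the trivial group for `n ≥ 3`**, as a cardinality. [cite: Milnor1970, §2 Theorem 2.3 (p0008 L12–L16); §1 Example 1.5 (p0004 L8–L12)] -/
theorem natCard_ratFunc_eq_one : Nat.card (MilnorK (RatFunc F) (n + 3)) = 1 :=
  Nat.card_eq_one_iff_exists.2 ⟨0, fun z => eq_zero_of_finite_ratFunc z⟩

/-- **`K₂𝔽_q(t) ≅ ⊕_𝔭 K₁(𝔽_q[t]/𝔭)`** (Tate): for finite `F` the boundary map `∂ = (∂_𝔭)_𝔭 : K₂F(t) → ⊕_𝔭 K₁(F[t]/𝔭)` is a bijection, since `K₂F = 0` by EXAMPLE 1.5; with `K₁(F[t]/𝔭) ≅ (F[t]/𝔭)^×` (`MilnorK.oneEquiv`) this is `K₂𝔽_q(t) ≅ ⊕_π (𝔽_q[t]/(π))^×`. (The same statement for the tree's `K2Infty (RatFunc F)` is `k2TameEquivOfFinite` of `KTwoRatFuncSymbolsFactor`.) [cite: Milnor1970, §2 Theorem 2.3 (p0008 L12–L16); §1 Example 1.5 (p0004 L8–L12)] -/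
theorem bijective_boundaryFamily_two_of_finite :
    Function.Bijective (boundaryFamily : MilnorK (RatFunc F) 2 → FinSuppFamily F 1) :=
  bijective_boundaryFamily_of_forall_eq_zero (n := 1) fun x => eq_zero_of_finite x

/-- `K₂𝔽_q(t)`: an element is determined by its boundaries — `z = 0 ↔ ∂_𝔭 z = 0` for all `𝔭`. [cite: Milnor1970, §2 Theorem 2.3 (p0008 L12–L16); §1 Example 1.5 (p0004 L8–L12)] -/
theorem eq_zero_iff_forall_boundaryAt_eq_zero_of_finite (z : MilnorK (RatFunc F) 2) :
    z = 0 ↔ ∀ v : HeightOneSpectrum F[X], boundaryAt F 1 v z = 0 := by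
  refine ⟨fun h v => by rw [h, map_zero], fun h => ?_⟩
  refine bijective_boundaryFamily_two_of_finite.1 (Subtype.ext (funext fun v => ?_))
  rw [boundaryFamily_apply, boundaryFamily_apply, map_zero, h v]

end FiniteField

end MilnorK

end Literature.RingTheory.KTheory

end
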